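import Summits.CriticalPhenomena.PercolationContinuityZ3.Theorems.PercNearOneGluingNoHeavyLowerTailSahiOneStepProfileGridChainRule
import HarnessLib

/-!
# The OR-CYLINDER STEP — fibres of one coordinate: point restriction of the weight, slot shift, ball monotonicity (Efron)

Prover prim-ineq-prove-3 gen 45 (`--supports stmt-CriticalPhenomena-4575`; memo
`run/shared/lean/prim/prim-ineq-prove-3/PROOF-G45-CHAIN-RULE.md` §5).  Second preliminary file for the OR-step (after
`…ProfileGridOrStepPrelim`): the product weight restricted to one value `y` of coordinate `i` (`piWeight_update_point`, still `PF₂`),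
the block sum split off coordinate `i` (`blockSum_univ_eq_add_erase`), prefix sums of Efron's layer functional as grid sums
(`sum_range_laySum_eq`), and **BALL MONOTONICITY ON A FIBRE** (`ball_mono_fibre`): for a monotone density `a` (`u = a·Φ`), on the fibre
`{v_i = y}` the `u/Φ`-ratio of the ball `{Σ v < t}` is at most that of the larger ball `{x + Σ_{j≠i} v_j < t}` (`x ≤ y`) — Efron's
theorem (`Literature.…efron_prefix_mul_le`) for the other coordinates.  No definitions, no sorries.
-/

noncomputable section

namespace Summit.CriticalPhenomena.PercolationContinuityZ3.Theorems

namespace SahiOneStep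

namespace ProfileGrid

open Finset Function
open Literature.Probability.Distributions (IsLogConcaveSeq piWeight blockSum laySum laySum_def efron_prefix_mul_le)
open scoped Classical

variable {κ : Type*} [Fintype κ] [DecidableEq κ] {N : ℕ}

/-! ## Point restriction of one factor -/

/-- Restricting `φ_i` to the single value `y` multiplies the product weight by `1[v_i = y]`. [folklore] -/
theorem piWeight_update_point (φ : κ → ℕ → ℝ) (i : κ) (y : ℕ) (v : κ → Fin (N + 1)) :
    piWeight N (update φ i (fun n => if n = y then φ i n else 0)) v = if (v i : ℕ) = y then piWeight N φ v else 0 := by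
  rw [piWeight_eq_mul_erase _ i, piWeight_eq_mul_erase φ i, update_self]
  have : ∏ j ∈ univ.erase i, update φ i (fun n => if n = y then φ i n else 0) j (v j) = ∏ j ∈ univ.erase i, φ j (v j) :=
    prod_congr rfl fun j hj => by rw [update_of_ne (ne_of_mem_erase hj)]
  rw [this]
  split_ifs <;> simp

omit [Fintype κ] in
/-- The point-restricted factors are again `PF₂`. [cite: Karlin1968, Ch. 8 §1] -/
theorem isLogConcaveSeq_update_point {φ : κ → ℕ → ℝ} (hφ : ∀ j, IsLogConcaveSeq (φ j)) (i : κ) (y : ℕ) (j : κ) :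
    IsLogConcaveSeq (update φ i (fun n => if n = y then φ i n else 0) j) := by
  by_cases hj : j = i
  · subst hj; rw [update_self]
    have h := ((hφ j).truncGE y).truncLE y
    have e : (fun n => if n ≤ y then (if y ≤ n then φ j n else 0) else 0) = fun n => if n = y then φ j n else 0 := by
      funext n
      by_cases h1 : n = y
      · subst h1; simp
      · by_cases h2 : n ≤ y
        · rw [if_pos h2, if_neg (by omega), if_neg h1]
        · rw [if_neg h2, if_neg h1]
    rw [e] at h; exact h
  · rw [update_of_ne hj]; exact hφ j

/-! ## Splitting the block sum off coordinate `i` -/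

/-- `Σ_j v_j = v_i + Σ_{j ≠ i} v_j`. [folklore] -/
theorem blockSum_univ_eq_add_erase (v : κ → Fin (N + 1)) (i : κ) :
    blockSum univ v = (v i : ℕ) + blockSum (univ.erase i) v := by
  unfold blockSum; rw [← add_sum_erase univ (fun j => (v j : ℕ)) (mem_univ i)]

/-- The block sum over `j ≠ i` does not see coordinate `i`. [folklore] -/
theorem blockSum_erase_update (v : κ → Fin (N + 1)) (i : κ) (x : Fin (N + 1)) :
    blockSum (univ.erase i) (update v i x) = blockSum (univ.erase i) v := by
  unfold blockSum
  exact sum_congr rfl fun j hj => by rw [update_of_ne (ne_of_mem_erase hj)]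

/-- On the fibre `v_i = y`: `Σ v < t ↔ Σ_{j≠i} v_j < t − y` (naturals). [folklore] -/
theorem slot_fibre_iff {v : κ → Fin (N + 1)} {i : κ} {y : ℕ} (hv : (v i : ℕ) = y) (t : ℕ) :
    blockSum univ v < t ↔ blockSum (univ.erase i) v < t - y := by
  rw [blockSum_univ_eq_add_erase v i, hv]; omega

/-- `Σ_j (v with v_i := x)_j < t ↔ Σ_{j≠i} v_j < t − x` (naturals). [folklore] -/
theorem slot_update_iff (v : κ → Fin (N + 1)) (i : κ) (x : Fin (N + 1)) (t : ℕ) :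
    blockSum univ (update v i x) < t ↔ blockSum (univ.erase i) v < t - (x : ℕ) := by
  rw [blockSum_univ_eq_add_erase _ i, update_self, blockSum_erase_update]; omega

/-- The block sum over `j ≠ i` is at most `N · |κ|`. [folklore] -/
theorem blockSum_erase_le (v : κ → Fin (N + 1)) (i : κ) : blockSum (univ.erase i) v ≤ N * Fintype.card κ := by
  unfold blockSum
  calc ∑ j ∈ univ.erase i, (v j : ℕ) ≤ ∑ j ∈ univ.erase i, N := sum_le_sum fun j _ => Nat.lt_succ_iff.1 (v j).2
    _ ≤ ∑ _j ∈ (univ : Finset κ), N := sum_le_sum_of_subset_of_nonneg (erase_subset _ _) fun _ _ _ => Nat.zero_le _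
    _ = N * Fintype.card κ := by rw [sum_const, smul_eq_mul, mul_comm]; rfl

/-! ## Prefix sums of the layer functional as grid sums -/

/-- `Σ_{s < c} L_K(Φ, s) = Σ_v 1[Σ_K v < c]·Π w(v)·Φ(v)`. [folklore] -/
theorem sum_range_laySum_eq (w : κ → ℕ → ℝ) (K : Finset κ) (Φ : (κ → Fin (N + 1)) → ℝ) (c : ℕ) :
    ∑ s ∈ range c, laySum N w K Φ s = ∑ v : κ → Fin (N + 1), if blockSum K v < c then piWeight N w v * Φ v else 0 := by
  simp only [laySum_def]
  rw [sum_comm]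
  refine sum_congr rfl fun v _ => ?_
  by_cases h : blockSum K v < c
  · rw [if_pos h, sum_ite_eq (range c) (blockSum K v) (fun _ => piWeight N w v * Φ v), if_pos (mem_range.2 h)]
  · rw [if_neg h]
    exact sum_eq_zero fun s hs => by rw [if_neg]; intro h'; exact h (h' ▸ mem_range.1 hs)

/-- Tilted full-range sums: `Σ_{s ≤ M} 1[s < c']·L_K(Φ, s) = Σ_v 1[Σ_K v < c']·Π w(v)·Φ(v)` when every block sum is `≤ M`. [folklore] -/
theorem sum_range_ite_laySum_eq (w : κ → ℕ → ℝ) (K : Finset κ) (Φ : (κ → Fin (N + 1)) → ℝ) (c' : ℕ) {M : ℕ}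
    (hM : ∀ v : κ → Fin (N + 1), blockSum K v ≤ M) :
    ∑ s ∈ range (M + 1), (if s < c' then (1 : ℝ) else 0) * laySum N w K Φ s =
      ∑ v : κ → Fin (N + 1), if blockSum K v < c' then piWeight N w v * Φ v else 0 := by
  simp only [laySum_def, mul_sum]
  rw [sum_comm]
  refine sum_congr rfl fun v _ => ?_
  have hv : blockSum K v ∈ range (M + 1) := mem_range.2 (Nat.lt_succ_of_le (hM v))
  rw [← sum_filter_add_sum_filter_not (range (M + 1)) (fun s => s = blockSum K v)]
  have h1 : (range (M + 1)).filter (fun s => s = blockSum K v) = {blockSum K v} := by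
    ext s; simp only [mem_filter, mem_range, mem_singleton]
    constructor
    · rintro ⟨_, h⟩; exact h
    · intro h; exact ⟨h ▸ Nat.lt_succ_of_le (hM v), h⟩
  rw [h1, sum_singleton, if_pos rfl, sum_eq_zero (fun s hs => by
    rw [mem_filter] at hs; rw [if_neg (Ne.symm hs.2), mul_zero]), add_zero]
  by_cases h : blockSum K v < c'
  · rw [if_pos h, if_pos h, one_mul]
  · rw [if_neg h, if_neg h, zero_mul]

/-! ## Ball monotonicity on a fibre (Efron) -/

/-- **BALL MONOTONICITY ON A FIBRE.**  `φ_j` all `PF₂`, `u = a·Φ` with `a` non-decreasing, a value `y` of coordinate `i`, a shift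
`x ≤ y` and a level `t`.  On the fibre `{v_i = y}` the ball `{Σ v < t}` is contained in the shifted ball `{Σ_j (v|v_i:=x)_j < t}`, and
the `u`-density of the former is at most that of the latter:
`u(fibre ∩ ball)·Φ(fibre ∩ shifted ball) ≤ u(fibre ∩ shifted ball)·Φ(fibre ∩ ball)`. [cite: Efron1965, Thm 1 (Cor.)] -/
theorem ball_mono_fibre (φ : κ → ℕ → ℝ) (hφ : ∀ j, IsLogConcaveSeq (φ j)) {u a : (κ → Fin (N + 1)) → ℝ} (ha : Monotone a)
    (hua : ∀ v, u v = a v * piWeight N φ v) (i : κ) (y : ℕ) (x : Fin (N + 1)) (hxy : (x : ℕ) ≤ y) (t : ℕ) :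
    (∑ v : κ → Fin (N + 1), if (v i : ℕ) = y ∧ blockSum univ v < t then u v else 0) *
        (∑ v : κ → Fin (N + 1), if (v i : ℕ) = y ∧ blockSum univ (update v i x) < t then piWeight N φ v else 0) ≤
      (∑ v : κ → Fin (N + 1), if (v i : ℕ) = y ∧ blockSum univ (update v i x) < t then u v else 0) *
        (∑ v : κ → Fin (N + 1), if (v i : ℕ) = y ∧ blockSum univ v < t then piWeight N φ v else 0) := by
  set φy : κ → ℕ → ℝ := update φ i (fun n => if n = y then φ i n else 0) with hφy
  have hφy_lc : ∀ j, IsLogConcaveSeq (φy j) := isLogConcaveSeq_update_point hφ i y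
  have hwy : ∀ v, piWeight N φy v = if (v i : ℕ) = y then piWeight N φ v else 0 := piWeight_update_point φ i y
  set K : Finset κ := univ.erase i with hK
  set M : ℕ := N * Fintype.card κ with hMdef
  have hM : ∀ v : κ → Fin (N + 1), blockSum K v ≤ M := fun v => blockSum_erase_le v i
  set c : ℕ := min (t - y) (M + 1) with hc
  have hcM : c ≤ M + 1 := min_le_right _ _
  have hω : ∀ s, 0 ≤ (if s < t - (x : ℕ) then (1 : ℝ) else 0) := fun s => by split_ifs <;> norm_num
  have key := efron_prefix_mul_le φy hφy_lc K a ha (fun s => if s < t - (x : ℕ) then (1 : ℝ) else 0) hω hcM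
  -- the four sums
  have conv_c : ∀ v : κ → Fin (N + 1), (blockSum K v < c) ↔ blockSum K v < t - y := fun v => by
    rw [hc, lt_min_iff]; exact ⟨fun h => h.1, fun h => ⟨h, Nat.lt_succ_of_le (hM v)⟩⟩
  have hprefix_c : ∀ (Φ : (κ → Fin (N + 1)) → ℝ),
      ∑ s ∈ range c, (if s < t - (x : ℕ) then (1 : ℝ) else 0) * laySum N φy K Φ s =
        ∑ v : κ → Fin (N + 1), if (v i : ℕ) = y ∧ blockSum univ v < t then piWeight N φ v * Φ v else 0 := by
    intro Φ
    have h1 : ∑ s ∈ range c, (if s < t - (x : ℕ) then (1 : ℝ) else 0) * laySum N φy K Φ s = ∑ s ∈ range c, laySum N φy K Φ s :=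
      sum_congr rfl fun s hs => by
        have hs' : s < t - y := (lt_min_iff.1 (mem_range.1 hs)).1
        rw [if_pos (by omega), one_mul]
    rw [h1, sum_range_laySum_eq]
    refine sum_congr rfl fun v _ => ?_
    rw [hwy v]
    by_cases hv : (v i : ℕ) = y
    · rw [if_pos hv]
      by_cases h2 : blockSum univ v < t
      · have h2' : blockSum K v < c := (conv_c v).2 ((slot_fibre_iff hv t).1 h2)
        rw [if_pos h2', if_pos ⟨hv, h2⟩]
      · have h2' : ¬ blockSum K v < c := fun h' => h2 ((slot_fibre_iff hv t).2 ((conv_c v).1 h'))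
        rw [if_neg h2', if_neg (fun h => h2 h.2)]
    · rw [if_neg hv, zero_mul, ite_self, if_neg (fun h => hv h.1)]
  have hfull : ∀ (Φ : (κ → Fin (N + 1)) → ℝ),
      ∑ s ∈ range (M + 1), (if s < t - (x : ℕ) then (1 : ℝ) else 0) * laySum N φy K Φ s =
        ∑ v : κ → Fin (N + 1), if (v i : ℕ) = y ∧ blockSum univ (update v i x) < t then piWeight N φ v * Φ v else 0 := by
    intro Φ
    rw [sum_range_ite_laySum_eq φy K Φ (t - (x : ℕ)) hM]
    refine sum_congr rfl fun v _ => ?_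
    rw [hwy v]
    by_cases hv : (v i : ℕ) = y
    · rw [if_pos hv]
      by_cases h2 : blockSum univ (update v i x) < t
      · have h2' : blockSum K v < t - (x : ℕ) := (slot_update_iff v i x t).1 h2
        rw [if_pos h2', if_pos ⟨hv, h2⟩]
      · have h2' : ¬ blockSum K v < t - (x : ℕ) := fun h' => h2 ((slot_update_iff v i x t).2 h')
        rw [if_neg h2', if_neg (fun h => h2 h.2)]
    · rw [if_neg hv, zero_mul, ite_self, if_neg (fun h => hv h.1)]
  rw [hprefix_c a, hfull (fun _ => 1), hprefix_c (fun _ => 1), hfull a] at key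
  have s1 : (∑ v : κ → Fin (N + 1), if (v i : ℕ) = y ∧ blockSum univ v < t then piWeight N φ v * a v else 0) =
      ∑ v : κ → Fin (N + 1), if (v i : ℕ) = y ∧ blockSum univ v < t then u v else 0 :=
    sum_congr rfl fun v _ => by rw [hua v, mul_comm]
  have s2 : (∑ v : κ → Fin (N + 1), if (v i : ℕ) = y ∧ blockSum univ (update v i x) < t then piWeight N φ v * a v else 0) =
      ∑ v : κ → Fin (N + 1), if (v i : ℕ) = y ∧ blockSum univ (update v i x) < t then u v else 0 :=
    sum_congr rfl fun v _ => by rw [hua v, mul_comm]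
  have s3 : (∑ v : κ → Fin (N + 1), if (v i : ℕ) = y ∧ blockSum univ v < t then piWeight N φ v * (fun _ => (1 : ℝ)) v else 0) =
      ∑ v : κ → Fin (N + 1), if (v i : ℕ) = y ∧ blockSum univ v < t then piWeight N φ v else 0 :=
    sum_congr rfl fun v _ => by simp
  have s4 : (∑ v : κ → Fin (N + 1),
        if (v i : ℕ) = y ∧ blockSum univ (update v i x) < t then piWeight N φ v * (fun _ => (1 : ℝ)) v else 0) =
      ∑ v : κ → Fin (N + 1), if (v i : ℕ) = y ∧ blockSum univ (update v i x) < t then piWeight N φ v else 0 :=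
    sum_congr rfl fun v _ => by simp
  rw [s1, s2, s3, s4] at key
  exact key.trans (le_of_eq (mul_comm _ _))

end ProfileGrid

end SahiOneStep

end Summit.CriticalPhenomena.PercolationContinuityZ3.Theorems
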